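import Literature.MathematicalPhysics.QuantumFieldTheory.Balaban1983to89.Node00.HistoryTermDatum214LocalGrowth
import Literature.MathematicalPhysics.QuantumFieldTheory.Balaban1983to89.B13Lemma2LeadingParts

/-!
# NODE 00 (YM-PLAN Track A) — W1 = [II] §2 (2.13)–(2.14), STOREY 12b: LEMMA 2's SENTENCE PER LOCALIZATION DOMAIN AS ONE RECORD
# (`W1.TermDatum214.Lemma2Inputs`), ITS LOCATED EXTENSION (`W1.TermDatum214.AnalyticGrowthInputs`) AND THE CONSTRUCTOR
# `W1.TermDatum214.LocalGrowthInputs.ofAnalytic` OF STOREY 12's LOCAL GROWTH RECORD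

NODE 00 DEFINER MODULE (seat `pub-ymgap-node00-def-W1`, generation 15, 2026-08-27).  APPEND-ONLY: a NEW importing module; g14's
`Node00/HistoryTermDatum214LocalGrowth` (`LocalGrowthInputs`, `LocalGrowthLetters`, `UnscaledBoxLaws`) and dag-n10-c's
`B13Lemma2LeadingParts` (module 48: `ofRealVec`, `wilsonR`, `cubicPart`, `olderR`, `linPart`, `wilson_letters`, `wilson_loc`,
`consts_nonneg`, `older_letters`, `linPart_eq_fderiv`, `loc_of_cubic_of_local`) untouched and CONSUMED BY NAME.  Typed on the
pub-ymgap bus demand d15 of the cell's transfer lens `ym-lens-BalabanUVNodes-transfer` g19 (2026-08-27 14:16Z, `LENS-transfer.md`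
§25.2: «a CONSTRUCTOR `LocalGrowthInputs.ofAnalytic` from the per-Y analytic record (`Wc Oc`, `h𝒲re`, `h𝒪re`, ONE radius R,
`M M₀ : 𝐃om → ℝ` (typed `M𝒲 M𝒪`: `M` is the block-count parameter of the datum), `hWd hWM hWB hOd hOM`, S-locality) + the non-Lemma-2 fields (h𝒲m h𝒪m, R_τ, hUτR, S, cubeOf, hS, Cp κp hCp hκp,
PROFILE `hdecay : R_τ Y * (M Y ∕ R^3) ≤ Cp·exp(−κp·dj Y)`, S₀, hbox, hloc𝒲, hloc𝒪), FILLING `𝒲₃ := cubicPart ∘ Wc`, `D𝒪 := linPart ∘ Oc`,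
… and all letters by `wilson_letters ∕ wilson_loc ∕ older_letters ∕ consts_nonneg` — then N09 inhabits ONLY print's sentence + profile
+ cube-location»), after the port of the lens's Sketch19 into the tree by seat `pub-ymgap-dag-n10-c` g7 (module 48, 2026-08-27 14:37Z:
«W1-12b's constructor can key on these names»), for the consumers of storey 12 (seat `pub-ymgap-dag-n22-c`'s J10 reads `I.` only).
[II] = [Balaban1988RG2Cluster] T. Bałaban, *Renormalization group approach to lattice gauge field theories. II. Cluster expansions*,
Commun. Math. Phys. **116** (1988) 1–22; [I] = [Balaban1987RG1], part I, Commun. Math. Phys. **109** (1987) 249–301.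

CITATION HEADER (PDF held: `paper:balaban1988-cmp116-rg-ii-cluster`, journal page = PDF page; `paper:balaban1987-cmp109-rg-i-small-field`,
journal page = PDF page + 248).  [II] p. 9, Lemma 1 (1.33)–(1.36): *"For each term in the sum there exists a function 𝐕′_k(Y, U, J, B),
defined and analytic on the space 𝔘ᶜ_{k+1}(Y, (1+β)α₀, (1+β)α₁, ε₀) × {B : |B| < ε₁g_k⁻¹ on Y}, (1.34) i.e. it depends on configurations
U, J, B restricted to the interior of Y"* and *"|𝐕″_k(Y,U,J,B)| ≤ |B|₀ε₁C₁M… exp C₂κ₁ exp(−(1−2δ)κ d_k(Y)). (1.36)"*; p. 10, between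
(1.38) and (1.39): *"The above expression is localized in the interior of Y, with respect to U, J, B′ or B. It is an analytic function
of (U, J) in the space …, and of B′ in the domain {B′ : e^{16κ₁}|B′| ≤ a₁ on Y}"*, with the cubic bound (1.39)
*"|(1.38)| ≤ C₃(e^{16κ₁}|B′|)³M⁴exp(−(κ₁−1)M⁻⁴|Y∖□|)"*; p. 11, Lemma 2 (1.41)–(1.43): *"For each term in the sum there exists a function
𝐕_k(Y,U,J,B), defined and analytic on the space (1.34) … This function is a sum of two terms (1.42) … and the function 𝐕″_k(Y,B)
satisfies the bound (1.36)"*; [I] p. 266 (2.8)–(2.9): *"Denoting terms of at least third order in H₁B′ by V(H₁B′)"*, *"χ_k = Π χ({|B′(b)|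
< ε₁})"*.  LANDED IN THE TREE (dag-n10-c, module 48 `B13Lemma2LeadingParts`): how this one sentence — ANALYTIC on a `Y`-free complex
sup-ball of the unscaled field, SUP-BOUNDED with domain-dependent constants, the Wilson remainder BEGINNING AT THIRD ORDER, LOCALIZED
in `Y` — yields the located letters of storey 12 with explicit constants `c₃ = c₃′ = M∕R³`, `c₄ = 2M∕R⁴`, `c₀ = M₀`, `c₁ = c₁′ =
2M₀∕R`, `c₂ = 4M₀∕R²`, the cubic part `homPart 𝒲ᶜ 3`, the differential `homPart (𝒪ᶜ − 𝒪ᶜ(0)) 1`, their homogeneity and measurability.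

THE PIN.  Storey 12 typed the local growth schema of the unscaled-field law's potentials as ONE record `𝔇.LocalGrowthInputs χᵘ 𝒲 𝒪 Z t
old φ Uτ` whose LEMMA-2-TYPE fields (`𝒲₃, D𝒪`, measurability and homogeneity of the parts, the constants `c₀ c₃ c₃′ c₄ c₁ c₁′ c₂`, the
letters (L0)–(L6), (ℓ1)) were PRIMITIVE.  THIS STOREY TYPES PRINT'S SENTENCE ITSELF, per localization domain `Y ∈ 𝐃_k` (the tree's
`TDom` IS print's 𝐃_k, so Lemma 2 speaks of EVERY `Y`), and DERIVES every Lemma-2-type field from it by module 48: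
* §1 the complex-field data types `𝔇.ComplexWilson ∕ 𝔇.ComplexOlder` and their real slices `realSliceWilson ∕ realSliceOlder` (an
  inhabitant who STARTS from complex potentials gets the real-slice identities by `rfl`);
* §2 **`𝔇.Lemma2Inputs 𝒲 𝒪 Z t old φ`** (Type-valued record; a LIST OF HYPOTHESES on the opaque `𝒲, 𝒪` of W1-11's law — nothing
  asserted): per `Y`, complex potentials `𝒲ᶜ(Y,·), 𝒪ᶜ(Y,·)` on the complexified row-bond field whose REAL SLICES are `𝒲(φ;Y,·), 𝒪(old,φ;Y,·)`
  (`h𝒲re ∕ h𝒪re`), ONE radius `R > 0` (print's `a₁e^{−16κ₁}`, `Y`-free), per-domain sup bounds `M𝒲(Y), M𝒪(Y)` ((1.39) ∕ (1.36): domain-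
  dependent through the decay factors), complex-differentiability and the sup bounds on the sup-ball `ball 0 R` (`hWd hWM hOd hOM`), the
  third-order onset `BeginsAt (𝒲ᶜ Y) 3` ([I] (2.8); the producer's constructor is module 48 v1.1's `beginsAt_three`), and the `Y`-LOCALITY of
  both potentials through the bond supports `S Y` ((1.34): *"restricted to the interior of Y"*); faces = THE LETTERS AT PRINT LEVEL (every `Y`,
  by name): `cubicPart_smul`, `h1_of ∕ h1loc_of ∕ h2_of` on any sup-ball `‖A‖ ≤ ρ`, `ρ < R`, the global `h3`, `measurable_cubicPart`, `h0`,
  `linPart_smul`, `h4_of ∕ h5_of`, the global `h6`, `measurable_linPart`, `linPart_eq_fderiv` (the differential IS `D𝒪ᶜ(Y)(0)` on real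
  fields), nonnegativity of `M𝒲, M𝒪`;
* §3 **`𝔇.AnalyticGrowthInputs χᵘ 𝒲 𝒪 Z t old φ Uτ extends Lemma2Inputs`** — the LOCATED non-Lemma-2 block of storey 12 next to the
  sentence: a box radius `0 < ρ < R` (print's `ε₁` inside the analyticity ball), measurability of the real slices, the τ-radii bounds `Rτ(Y)`
  of the regions `Uτ`, the cube-location `cubeOf` with (G) `b ∈ S Y → cubeOf b ∈ Y`, the (2.19) PROFILE constants with
  `hdecay : Rτ(Y)·(M𝒲(Y)∕R³) ≤ C_p e^{−κ_p d_k(Y)}` (`κ_p ≥ κ₀(4·2^d, 2d)`), the box-support set `S₀` with (2.2) `S Y ⊆ S₀` on `𝐃` and the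
  s-free box-support law; and **THE CONSTRUCTOR `LocalGrowthInputs.ofAnalytic J`** filling `𝒲₃ Y := cubicPart (𝒲ᶜ Y)`, `D𝒪 Y := linPart (𝒪ᶜ Y)`,
  `c₃ = c₃′ := M𝒲∕R³`, `c₄ := 2M𝒲∕R⁴`, `c₀ := M𝒪`, `c₁ = c₁′ := 2M𝒪∕R`, `c₂ := 4M𝒪∕R²`, `R := Rτ`, `S := S`, every letter by module 48 BY
  NAME, the `S₀`-localities from `Y`-locality + `S Y ⊆ S₀`; rfl faces per field, `ofAnalytic_m₃` (the derived per-bond multiplicity reads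
  `C_p·K₀(4·2^d, 2d)`), `ofAnalytic_D𝒪_eq_fderiv`, the shadow `AnalyticGrowthLetters → LocalGrowthLetters`, `restrict` + `ofAnalytic_restrict`;
  §3b the same shadows OVER AN ADMISSIBLE CLASS `Adm` of older terms (`AnalyticGrowthLettersOn ∕ LocalGrowthLettersOn Adm Z t φ Uτ :=
  ∀ old ∈ Adm, …`, antitone in `Adm`) — the consumer's binder shape under the lens's decision request d16, repair (R-a): the datum's law stays
  TOTAL and faithful in `old` (W1-11), the Lemma-2-type hypotheses are asked only over the admissible class, W1's uninstantiated parameter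
  `Adm : (k : ℕ) → Set (OlderTerms P 𝔸 M k)` of `RecAdmissible ∕ StepGen.AnalyticInLast ∕ StepGen.PropagatesAnalyticity` (storey 4,
  `HistoryRecursionOfRecord` §3; [I] p. 263 (1.18) *"defined and analytic"*), which the consumer instantiates (size ∧ field-analyticity);
* §4 HONESTY — the schema is consistent: the zero complex potentials (`R = 1`, `M𝒲 = M𝒪 = 0`, empty supports) inhabit `Lemma2Inputs` for the
  zero real potentials, extend to `AnalyticGrowthInputs` as soon as the τ-regions are bounded on `𝐃`, and `ofAnalytic` of that witness
  yields storey 12's record with the expected faces (`ofAnalytic_zero_ρ_c₃`; storey 12's own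
  `localGrowthLetters_zero` is the landed shadow witness and is not restated).
All proofs are projections ∕ `rfl` ∕ one application each of module 48's corollaries; NO estimate of Bałaban's is proved or asserted.

WHAT IS LEFT TO THE CONSUMERS (not typed here — one declarer each): the inhabitant OF RECORD of `Lemma2Inputs` ∕ `AnalyticGrowthInputs`
at NODE 00's datum (N09 ∕ NODE A: Lemma 2's construction (1.33)–(1.43) from def-B13's kernels — analyticity on the `Y`-free sup-ball, the
sup bounds `M𝒲(Y), M𝒪(Y)` by (1.39) ∕ (1.36), the onset (`beginsAt_three`), `Y`-locality — plus the (2.19) profile per matrix element and the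
cube-location, for `old` in the admissible class only (§3b);
print-shaped data only: NO Taylor letter, NO cubic part, NO kernel bound is asked of the producer any more); the member statements at the
datum (seat `pub-ymgap-dag-n22-c`'s J-files, reading `I := LocalGrowthInputs.ofAnalytic J` field by field, unchanged).

HONEST FRAMING: records that are LISTS OF HYPOTHESES (inhabited only by supplying print's sentence and the located data; §4 shows they
are not contradictory), their faces, and a constructor whose every letter is ONE application of a tree corollary of elementary complex
analysis (module 48, credited there to the lens's Sketch19); NO estimate of Bałaban's asserted or constructed; SCOPE (inherited from
W1-11 ∕ W1-12; referee ref-H WATCH-239, 2026-08-27): the sup-ball `‖A‖ ≤ ρ` inside the analyticity ball `‖A‖ < R` and the box-support law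
are the OPTION-1 reading of [I] p. 266 (threshold `ε₁` on the UNSCALED field `B′`); the inhabitant-of-record author states which threshold
NODE 00's datum carries before instantiating; N22 ∕ N10 ∕ N09 ∕ NODE A NOT discharged; K3 untouched; counts unmoved; one finite 𝕋⁴
programme at fixed ε, Bałaban as printed — NOT continuum ∕ ℝ⁴ ∕ infinite volume ∕ OS ∕ mass gap ∕ Clay.  No `sorry`, no `axiom`, no
`instance` declaration, no `notation`.

References (TYPES and page anchors only): [II] Lemma 1 (1.33)–(1.36) p. 9, (1.38)–(1.39) p. 10, Lemma 2 (1.41)–(1.43) p. 11, (2.2)–(2.3)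
p. 12, (2.14) p. 15, (2.18)–(2.20) p. 16, (1.26) p. 8; [I] (2.8)–(2.9) p. 266.
-/

open scoped BigOperators

noncomputable section

namespace Literature.MathematicalPhysics.QuantumFieldTheory.Balaban1983to89.Node00

open Metric Set MeasureTheory
open Literature.MathematicalPhysics.QuantumFieldTheory.Balaban1983to89
open TreeLengthTorus Sect2
open Literature.MathematicalPhysics.QuantumFieldTheory.Balaban1983to89.B12TreeDecay (K₀ kappa₀ K₀_pos)
open Literature.MathematicalPhysics.QuantumFieldTheory.Balaban1983to89.B13ExpansionOrder (BeginsAt homPart)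
open Literature.MathematicalPhysics.QuantumFieldTheory.Balaban1983to89.B13Lemma2LeadingParts (ofRealVec ofRealVec_zero wilsonR
  cubicPart olderR linPart wilson_letters wilson_loc older_letters linPart_eq_fderiv loc_of_cubic_of_local)

namespace W1

namespace TermDatum214

variable {c : B13.Consts} {P : Params} {𝔸 : Type*} {M k L : ℕ} [NeZero L] (𝔇 : TermDatum214 c P 𝔸 M k L)

/-! ## §1  The complex-field data types and their real slices -/

/-- **Data type: the Wilson remainder read in the COMPLEXIFIED unscaled row-bond field** (`𝒲ᶜ(φ; Y, A)`, `A : Λ → ℂ`; Lemma 2: *"an analytic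
function … of B′ in the domain {B′ : e^{16κ₁}|B′| ≤ a₁ on Y}"*), per `Z ∈ 𝐃_{k+1}` and term label; history-free like `UnscaledWilson`.
[cite: Balaban1988RG2Cluster, (1.38)-(1.39) p.10 and Lemma 2 (1.41)-(1.42) p.11; Balaban1987RG1, (2.8) p.266] -/
abbrev ComplexWilson : Type _ :=
  (Z : (domSys P M (k + 1)).Dom) → (t : TermLabel P M k L) → CPair P 𝔸 → TDom P.d (L * domCount P M (k + 1)) → ((𝔇.𝒦 Z t).Λ → ℂ) → ℂ

/-- **Data type: the older-terms part of the potentials read in the COMPLEXIFIED unscaled field** (`𝒪ᶜ(old, φ; Y, A)`; (1.34)–(1.36):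
`𝐕″_k(Y,U,J,B)` *"defined and analytic on … × {B : |B| < ε₁g_k⁻¹ on Y}"*).
[cite: Balaban1988RG2Cluster, Lemma 1 (1.33)-(1.36) p.9 and Lemma 2 (1.42) p.11; Balaban1987RG1, (2.10) p.267 and (2.12)-(2.13) p.268] -/
abbrev ComplexOlder : Type _ :=
  (Z : (domSys P M (k + 1)).Dom) → (t : TermLabel P M k L) → OlderTerms P 𝔸 M k → CPair P 𝔸 →
    TDom P.d (L * domCount P M (k + 1)) → ((𝔇.𝒦 Z t).Λ → ℂ) → ℂ

/-- **The real slice of a complex Wilson remainder**: `𝒲(φ; Y, A) := 𝒲ᶜ(φ; Y, (A_b)_b ↪ ℂ)` (module 48's `wilsonR` slot by slot).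
[cite: Balaban1988RG2Cluster, (1.38) p.10 and Lemma 2 (1.41) p.11 (bookkeeping)] -/
def realSliceWilson (Wc : 𝔇.ComplexWilson) : 𝔇.UnscaledWilson :=
  fun Z t φ Y A => Wc Z t φ Y (ofRealVec A)

/-- **The real slice of a complex older-terms part**: `𝒪(old, φ; Y, A) := 𝒪ᶜ(old, φ; Y, (A_b)_b ↪ ℂ)` (module 48's `olderR` slot by slot).
[cite: Balaban1988RG2Cluster, Lemma 1 (1.33)-(1.34) p.9 (bookkeeping)] -/
def realSliceOlder (Oc : 𝔇.ComplexOlder) : 𝔇.UnscaledOlder :=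
  fun Z t old φ Y A => Oc Z t old φ Y (ofRealVec A)

/-- `realSliceWilson` pointwise (`rfl`). [cite: Balaban1988RG2Cluster, Lemma 2 (1.41) p.11 (bookkeeping)] -/
@[simp] theorem realSliceWilson_apply (Wc : 𝔇.ComplexWilson) (Z : (domSys P M (k + 1)).Dom) (t : TermLabel P M k L) (φ : CPair P 𝔸)
    (Y : TDom P.d (L * domCount P M (k + 1))) (A : (𝔇.𝒦 Z t).Λ → ℝ) :
    𝔇.realSliceWilson Wc Z t φ Y A = Wc Z t φ Y (ofRealVec A) := rfl

/-- `realSliceOlder` pointwise (`rfl`). [cite: Balaban1988RG2Cluster, Lemma 1 (1.33) p.9 (bookkeeping)] -/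
@[simp] theorem realSliceOlder_apply (Oc : 𝔇.ComplexOlder) (Z : (domSys P M (k + 1)).Dom) (t : TermLabel P M k L) (old : OlderTerms P 𝔸 M k)
    (φ : CPair P 𝔸) (Y : TDom P.d (L * domCount P M (k + 1))) (A : (𝔇.𝒦 Z t).Λ → ℝ) :
    𝔇.realSliceOlder Oc Z t old φ Y A = Oc Z t old φ Y (ofRealVec A) := rfl

/-- `realSliceWilson Wc Z t φ Y` IS module 48's `wilsonR (Wc Z t φ Y)` (`rfl`). [cite: Balaban1988RG2Cluster, Lemma 2 (1.41) p.11 (bookkeeping)] -/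
theorem realSliceWilson_eq_wilsonR (Wc : 𝔇.ComplexWilson) (Z : (domSys P M (k + 1)).Dom) (t : TermLabel P M k L) (φ : CPair P 𝔸)
    (Y : TDom P.d (L * domCount P M (k + 1))) : 𝔇.realSliceWilson Wc Z t φ Y = wilsonR (Wc Z t φ Y) := rfl

/-- `realSliceOlder Oc Z t old φ Y` IS module 48's `olderR (Oc Z t old φ Y)` (`rfl`). [cite: Balaban1988RG2Cluster, Lemma 1 (1.33) p.9 (bookkeeping)] -/
theorem realSliceOlder_eq_olderR (Oc : 𝔇.ComplexOlder) (Z : (domSys P M (k + 1)).Dom) (t : TermLabel P M k L) (old : OlderTerms P 𝔸 M k)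
    (φ : CPair P 𝔸) (Y : TDom P.d (L * domCount P M (k + 1))) : 𝔇.realSliceOlder Oc Z t old φ Y = olderR (Oc Z t old φ Y) := rfl

variable (χu : 𝔇.UnscaledChi) (𝒲 : 𝔇.UnscaledWilson) (𝒪 : 𝔇.UnscaledOlder)

/-! ## §2  Lemma 2's sentence per localization domain at one term slice, as ONE record -/

/-- **LEMMA 2's SENTENCE AT THE TERM SLICE `(Z, t, old, φ)`, PER LOCALIZATION DOMAIN `Y ∈ 𝐃_k`** (Type-valued record; a LIST OF HYPOTHESES
on the coupling-free `𝒲, 𝒪` of W1-11's unscaled-field law — nothing asserted).  [II] Lemma 2 p. 11 with (1.34) p. 9 and p. 10: the term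
localized in `Y` is *"defined and analytic on the space (1.34)"* = *"an analytic function … of B′ in the domain {B′ : e^{16κ₁}|B′| ≤ a₁ on
Y}"*, *"it depends on configurations U, J, B restricted to the interior of Y"*, is *"a sum of two terms (1.42)"* — in the unscaled-field
law's reading the Wilson remainder `𝒲(φ; Y, ·)` (the part *"of at least third order in H₁B′"*, [I] (2.8), with the cubic sup bound (1.39))
and the older terms `𝒪(old, φ; Y, ·)` (`𝐕″`, bounded by (1.36)).  Fields: the complex potentials `𝒲ᶜ(Y,·), 𝒪ᶜ(Y,·)` on the
complexified row-bond field whose REAL SLICES are `𝒲(φ;Y,·), 𝒪(old,φ;Y,·)` (`h𝒲re ∕ h𝒪re`, for every real field — the inhabitant who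
defines `𝒲 := realSliceWilson 𝒲ᶜ` has them by `rfl`); ONE radius `R > 0` (print's `a₁e^{−16κ₁}`, `Y`-free); the per-domain sup bounds
`M𝒲(Y)` of `𝒲ᶜ(Y,·)` and `M𝒪(Y)` of `𝒪ᶜ(Y,·)` on the sup-ball `‖A‖ < R` (domain-dependent through the decay factors of (1.39) ∕ (1.36); `M` itself is
the datum's block count); complex-differentiability on that ball; the third-order onset `BeginsAt (𝒲ᶜ Y) 3` (a producer obtains it from
`𝒲ᶜ(0) = 0`, `D𝒲ᶜ(0) = 0` and the vanishing quadratic part by `B13Lemma2LeadingParts.beginsAt_three`); the bond supports `S Y` through which BOTH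
potentials read the field (`Y`-locality).  Every `Y : TDom` is quantified (the tree's `TDom` is print's `𝐃_k` and Lemma 2 speaks of *"each term in the sum"*
over `Y ∈ 𝐃_k`; W1-11's law pins `𝒲(φ; Y, ·), 𝒪(old, φ; Y, ·)` for every `Y` likewise).  NOT fields: the box radius, the τ-data, the
profile, the boxes (§3) — those are asked on the term's family `𝐃 = t.1` only.
[cite: Balaban1988RG2Cluster, Lemma 2 (1.41)-(1.43) p.11, (1.34) and (1.36) p.9, (1.38)-(1.39) p.10; Balaban1987RG1, (2.8)-(2.9) p.266] -/
structure Lemma2Inputs (Z : (domSys P M (k + 1)).Dom) (t : TermLabel P M k L) (old : OlderTerms P 𝔸 M k) (φ : CPair P 𝔸) where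
  -- the complex potentials per localization domain (Lemma 2's analytic functions of the unscaled field)
  Wc : TDom P.d (L * domCount P M (k + 1)) → ((𝔇.𝒦 Z t).Λ → ℂ) → ℂ
  Oc : TDom P.d (L * domCount P M (k + 1)) → ((𝔇.𝒦 Z t).Λ → ℂ) → ℂ
  -- ONE radius of analyticity in the sup norm of the unscaled field (print's a₁e^{−16κ₁}; Y-free)
  R : ℝ
  hR : 0 < R
  -- the per-domain sup bounds ((1.39) for the Wilson remainder, (1.36) for the older terms)
  M𝒲 : TDom P.d (L * domCount P M (k + 1)) → ℝ
  M𝒪 : TDom P.d (L * domCount P M (k + 1)) → ℝ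
  -- the real-slice identities: the law's potentials ARE the restrictions of the complex ones to real fields
  h𝒲re : ∀ (Y : TDom P.d (L * domCount P M (k + 1))) (A : (𝔇.𝒦 Z t).Λ → ℝ), 𝒲 Z t φ Y A = Wc Y (ofRealVec A)
  h𝒪re : ∀ (Y : TDom P.d (L * domCount P M (k + 1))) (A : (𝔇.𝒦 Z t).Λ → ℝ), 𝒪 Z t old φ Y A = Oc Y (ofRealVec A)
  -- analyticity and the sup bounds on the complex sup-ball, the third-order onset of the Wilson remainder
  hWd : ∀ Y, DifferentiableOn ℂ (Wc Y) (ball 0 R)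
  hWM : ∀ Y, ∀ z ∈ ball (0 : (𝔇.𝒦 Z t).Λ → ℂ) R, ‖Wc Y z‖ ≤ M𝒲 Y
  hWB : ∀ Y, BeginsAt (Wc Y) 3
  hOd : ∀ Y, DifferentiableOn ℂ (Oc Y) (ball 0 R)
  hOM : ∀ Y, ∀ z ∈ ball (0 : (𝔇.𝒦 Z t).Λ → ℂ) R, ‖Oc Y z‖ ≤ M𝒪 Y
  -- Y-locality: both potentials read the field through the bond supports `S Y` only ((1.34) «restricted to the interior of Y»)
  S : TDom P.d (L * domCount P M (k + 1)) → Finset (𝔇.𝒦 Z t).Λ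
  hloc𝒲 : ∀ (Y : TDom P.d (L * domCount P M (k + 1))) (A A' : (𝔇.𝒦 Z t).Λ → ℝ), (∀ b ∈ S Y, A b = A' b) → 𝒲 Z t φ Y A = 𝒲 Z t φ Y A'
  hloc𝒪 : ∀ (Y : TDom P.d (L * domCount P M (k + 1))) (A A' : (𝔇.𝒦 Z t).Λ → ℝ), (∀ b ∈ S Y, A b = A' b) →
    𝒪 Z t old φ Y A = 𝒪 Z t old φ Y A'

namespace Lemma2Inputs

variable {𝔇 𝒲 𝒪}
variable {Z : (domSys P M (k + 1)).Dom} {t : TermLabel P M k L} {old : OlderTerms P 𝔸 M k} {φ : CPair P 𝔸}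
variable (J : 𝔇.Lemma2Inputs 𝒲 𝒪 Z t old φ)

/-- The law's Wilson remainder at `Y` IS module 48's `wilsonR (𝒲ᶜ Y)` (from `h𝒲re`). [cite: Balaban1988RG2Cluster, Lemma 2 (1.41) p.11 (bookkeeping)] -/
theorem wilsonR_eq (Y : TDom P.d (L * domCount P M (k + 1))) : wilsonR (J.Wc Y) = 𝒲 Z t φ Y :=
  funext fun A => (J.h𝒲re Y A).symm

/-- The law's older terms at `Y` ARE module 48's `olderR (𝒪ᶜ Y)` (from `h𝒪re`). [cite: Balaban1988RG2Cluster, Lemma 1 (1.33) p.9 (bookkeeping)] -/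
theorem olderR_eq (Y : TDom P.d (L * domCount P M (k + 1))) : olderR (J.Oc Y) = 𝒪 Z t old φ Y :=
  funext fun A => (J.h𝒪re Y A).symm

/-- The sup bound of the Wilson remainder is nonnegative (it bounds `‖𝒲ᶜ(Y, 0)‖`). [cite: Balaban1988RG2Cluster, (1.39) p.10 (bookkeeping)] -/
theorem M𝒲_nonneg (Y : TDom P.d (L * domCount P M (k + 1))) : 0 ≤ J.M𝒲 Y :=
  (B13Lemma2LeadingParts.consts_nonneg J.hR (J.hWM Y)).2.2.1

/-- The sup bound of the older terms is nonnegative. [cite: Balaban1988RG2Cluster, (1.36) p.9 (bookkeeping)] -/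
theorem M𝒪_nonneg (Y : TDom P.d (L * domCount P M (k + 1))) : 0 ≤ J.M𝒪 Y :=
  (B13Lemma2LeadingParts.consts_nonneg J.hR (J.hOM Y)).2.2.1

/-- `0 ≤ M𝒲(Y)∕R³` (storey 12's `hc₃ ∕ hc₃′`). [cite: Balaban1988RG2Cluster, (1.39) p.10 (bookkeeping)] -/
theorem c₃_nonneg (Y : TDom P.d (L * domCount P M (k + 1))) : 0 ≤ J.M𝒲 Y / J.R ^ 3 :=
  (B13Lemma2LeadingParts.consts_nonneg J.hR (J.hWM Y)).1

/-- `0 ≤ 2M𝒲(Y)∕R⁴` (storey 12's `hc₄`). [cite: Balaban1988RG2Cluster, (1.39) p.10 (bookkeeping)] -/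
theorem c₄_nonneg (Y : TDom P.d (L * domCount P M (k + 1))) : 0 ≤ 2 * J.M𝒲 Y / J.R ^ 4 :=
  (B13Lemma2LeadingParts.consts_nonneg J.hR (J.hWM Y)).2.1

/-- `0 ≤ 2M𝒪(Y)∕R` (storey 12's `hc₁ ∕ hc₁′`). [cite: Balaban1988RG2Cluster, (1.36) p.9 (bookkeeping)] -/
theorem c₁_nonneg (Y : TDom P.d (L * domCount P M (k + 1))) : 0 ≤ 2 * J.M𝒪 Y / J.R :=
  (B13Lemma2LeadingParts.consts_nonneg J.hR (J.hOM Y)).2.2.2.1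

/-- `0 ≤ 4M𝒪(Y)∕R²` (storey 12's `hc₂`). [cite: Balaban1988RG2Cluster, (1.36) p.9 (bookkeeping)] -/
theorem c₂_nonneg (Y : TDom P.d (L * domCount P M (k + 1))) : 0 ≤ 4 * J.M𝒪 Y / J.R ^ 2 :=
  (B13Lemma2LeadingParts.consts_nonneg J.hR (J.hOM Y)).2.2.2.2

/-- **The cubic part is 3-homogeneous under real dilations** (storey 12's `h𝒲₃`), EVERY `Y`: `𝒲₃(Y, rA) = r³𝒲₃(Y, A)` for
`𝒲₃(Y,·) := cubicPart (𝒲ᶜ Y)` — module 48's `wilson_letters`. [cite: Balaban1988RG2Cluster, Lemma 2 (1.41)-(1.42) p.11 and (1.39) p.10; Balaban1987RG1, (2.8) p.266] -/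
theorem cubicPart_smul (Y : TDom P.d (L * domCount P M (k + 1))) (r : ℝ) (A : (𝔇.𝒦 Z t).Λ → ℝ) :
    cubicPart (J.Wc Y) (r • A) = (r : ℂ) ^ 3 * cubicPart (J.Wc Y) A :=
  (wilson_letters (half_lt_self J.hR) J.hR (J.hWd Y) (J.hWM Y) (J.hWB Y)).1 r A

/-- **(L1) at print level** (storey 12's `h1` with `c₃ = M𝒲(Y)∕R³`), EVERY `Y`, on any sup-ball `‖A‖ ≤ ρ` inside the analyticity ball:
`‖𝒲(φ; Y, A)‖ ≤ (M𝒲(Y)∕R³)‖A‖³` — module 48's `wilson_letters`. [cite: Balaban1988RG2Cluster, (1.39) p.10 and Lemma 2 (1.41) p.11; Balaban1987RG1, (2.8) p.266] -/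
theorem h1_of {ρ : ℝ} (hρR : ρ < J.R) (Y : TDom P.d (L * domCount P M (k + 1))) (A : (𝔇.𝒦 Z t).Λ → ℝ) (hA : ‖A‖ ≤ ρ) :
    ‖𝒲 Z t φ Y A‖ ≤ J.M𝒲 Y / J.R ^ 3 * ‖A‖ ^ 3 :=
  (congrArg (‖·‖) (J.h𝒲re Y A)).trans_le ((wilson_letters hρR J.hR (J.hWd Y) (J.hWM Y) (J.hWB Y)).2.1 A hA)

/-- **(ℓ1) at print level** (storey 12's `h1loc`, SAME constant): `‖𝒲(φ; Y, A)‖ ≤ (M𝒲(Y)∕R³)‖A‖Σ_{b∈S Y}A_b²` on `‖A‖ ≤ ρ < R` — (L1) + `Y`-locality,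
module 48's `loc_of_cubic_of_local`. [cite: Balaban1988RG2Cluster, (1.34) p.9 («restricted to the interior of Y») and (1.39) p.10, (2.20) p.16] -/
theorem h1loc_of {ρ : ℝ} (hρR : ρ < J.R) (Y : TDom P.d (L * domCount P M (k + 1))) :
    ∀ A : (𝔇.𝒦 Z t).Λ → ℝ, ‖A‖ ≤ ρ → ‖𝒲 Z t φ Y A‖ ≤ J.M𝒲 Y / J.R ^ 3 * ‖A‖ * ∑ b ∈ J.S Y, A b ^ 2 :=
  loc_of_cubic_of_local (J.S Y) (J.c₃_nonneg Y) (J.hloc𝒲 Y) (fun A hA => J.h1_of hρR Y A hA)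

/-- **(L2) at print level** (storey 12's `h2` with `c₄ = 2M𝒲(Y)∕R⁴`): `‖𝒲(φ;Y,A) − 𝒲₃(Y,A)‖ ≤ (2M𝒲(Y)∕R⁴)‖A‖⁴` on `‖A‖ ≤ ρ < R` — module 48's
`wilson_letters`. [cite: Balaban1988RG2Cluster, (1.39)-(1.40) p.10 and Lemma 2 (1.41) p.11; Balaban1987RG1, (2.8) p.266] -/
theorem h2_of {ρ : ℝ} (hρR : ρ < J.R) (Y : TDom P.d (L * domCount P M (k + 1))) (A : (𝔇.𝒦 Z t).Λ → ℝ) (hA : ‖A‖ ≤ ρ) :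
    ‖𝒲 Z t φ Y A - cubicPart (J.Wc Y) A‖ ≤ 2 * J.M𝒲 Y / J.R ^ 4 * ‖A‖ ^ 4 := by
  rw [J.h𝒲re]
  exact (wilson_letters hρR J.hR (J.hWd Y) (J.hWM Y) (J.hWB Y)).2.2.1 A hA

/-- **(L3) at print level, GLOBAL** (storey 12's `h3` with `c₃′ = M𝒲(Y)∕R³`): `‖𝒲₃(Y,A)‖ ≤ (M𝒲(Y)∕R³)‖A‖³` for EVERY real field — module 48's
`wilson_letters` (Cauchy bound transported by homogeneity). [cite: Balaban1988RG2Cluster, (1.39) p.10 and Lemma 2 (1.41) p.11] -/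
theorem h3 (Y : TDom P.d (L * domCount P M (k + 1))) (A : (𝔇.𝒦 Z t).Λ → ℝ) :
    ‖cubicPart (J.Wc Y) A‖ ≤ J.M𝒲 Y / J.R ^ 3 * ‖A‖ ^ 3 :=
  (wilson_letters (half_lt_self J.hR) J.hR (J.hWd Y) (J.hWM Y) (J.hWB Y)).2.2.2.1 A

/-- **Measurability of the cubic part from measurability of the real slice** (storey 12's `h𝒲₃m` from its `h𝒲m`) — module 48's
`wilson_letters` (pointwise limit). [cite: Balaban1988RG2Cluster, Lemma 2 (1.41) p.11 (bookkeeping)] -/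
theorem measurable_cubicPart (Y : TDom P.d (L * domCount P M (k + 1))) (h : Measurable (𝒲 Z t φ Y)) :
    Measurable (cubicPart (J.Wc Y)) :=
  (wilson_letters (half_lt_self J.hR) J.hR (J.hWd Y) (J.hWM Y) (J.hWB Y)).2.2.2.2 (J.wilsonR_eq Y ▸ h)

/-- **(L0) at print level** (storey 12's `h0` with `c₀ = M𝒪(Y)`): `‖𝒪(old, φ; Y, 0)‖ ≤ M𝒪(Y)` — module 48's `older_letters`.
[cite: Balaban1988RG2Cluster, (1.36) p.9 and Lemma 2 (1.42) p.11] -/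
theorem h0 (Y : TDom P.d (L * domCount P M (k + 1))) : ‖𝒪 Z t old φ Y 0‖ ≤ J.M𝒪 Y := by
  rw [J.h𝒪re]
  exact (older_letters (half_lt_self J.hR) J.hR (J.hOd Y) (J.hOM Y)).1

/-- **The differential is 1-homogeneous under real dilations** (storey 12's `hD𝒪`), EVERY `Y`: `D𝒪(Y, rA) = r·D𝒪(Y, A)` for
`D𝒪(Y,·) := linPart (𝒪ᶜ Y)` — module 48's `older_letters`. [cite: Balaban1988RG2Cluster, (1.36) p.9 and Lemma 2 (1.42) p.11] -/
theorem linPart_smul (Y : TDom P.d (L * domCount P M (k + 1))) (r : ℝ) (A : (𝔇.𝒦 Z t).Λ → ℝ) :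
    linPart (J.Oc Y) (r • A) = (r : ℂ) * linPart (J.Oc Y) A :=
  (older_letters (half_lt_self J.hR) J.hR (J.hOd Y) (J.hOM Y)).2.1 r A

/-- **(L4) at print level** (storey 12's `h4` with `c₁ = 2M𝒪(Y)∕R`): `‖𝒪(Y,A) − 𝒪(Y,0)‖ ≤ (2M𝒪(Y)∕R)‖A‖` on `‖A‖ ≤ ρ < R` — module 48's
`older_letters`. [cite: Balaban1988RG2Cluster, (1.36) p.9 and Lemma 2 (1.42) p.11; Balaban1987RG1, (2.12)-(2.13) p.268] -/
theorem h4_of {ρ : ℝ} (hρR : ρ < J.R) (Y : TDom P.d (L * domCount P M (k + 1))) (A : (𝔇.𝒦 Z t).Λ → ℝ) (hA : ‖A‖ ≤ ρ) :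
    ‖𝒪 Z t old φ Y A - 𝒪 Z t old φ Y 0‖ ≤ 2 * J.M𝒪 Y / J.R * ‖A‖ := by
  rw [J.h𝒪re, J.h𝒪re]
  exact (older_letters hρR J.hR (J.hOd Y) (J.hOM Y)).2.2.1 A hA

/-- **(L5) at print level** (storey 12's `h5` with `c₂ = 4M𝒪(Y)∕R²`): `‖𝒪(Y,A) − 𝒪(Y,0) − D𝒪(Y,A)‖ ≤ (4M𝒪(Y)∕R²)‖A‖²` on `‖A‖ ≤ ρ < R` —
module 48's `older_letters`. [cite: Balaban1988RG2Cluster, (1.36) p.9 and Lemma 2 (1.42) p.11; Balaban1987RG1, (2.12)-(2.13) p.268] -/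
theorem h5_of {ρ : ℝ} (hρR : ρ < J.R) (Y : TDom P.d (L * domCount P M (k + 1))) (A : (𝔇.𝒦 Z t).Λ → ℝ) (hA : ‖A‖ ≤ ρ) :
    ‖𝒪 Z t old φ Y A - 𝒪 Z t old φ Y 0 - linPart (J.Oc Y) A‖ ≤ 4 * J.M𝒪 Y / J.R ^ 2 * ‖A‖ ^ 2 := by
  rw [J.h𝒪re, J.h𝒪re]
  exact (older_letters hρR J.hR (J.hOd Y) (J.hOM Y)).2.2.2.1 A hA

/-- **(L6) at print level, GLOBAL** (storey 12's `h6` with `c₁′ = 2M𝒪(Y)∕R`): `‖D𝒪(Y,A)‖ ≤ (2M𝒪(Y)∕R)‖A‖` for EVERY real field — module 48's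
`older_letters`. [cite: Balaban1988RG2Cluster, (1.36) p.9 and Lemma 2 (1.42) p.11] -/
theorem h6 (Y : TDom P.d (L * domCount P M (k + 1))) (A : (𝔇.𝒦 Z t).Λ → ℝ) :
    ‖linPart (J.Oc Y) A‖ ≤ 2 * J.M𝒪 Y / J.R * ‖A‖ :=
  (older_letters (half_lt_self J.hR) J.hR (J.hOd Y) (J.hOM Y)).2.2.2.2.1 A

/-- **Measurability of the differential from measurability of the real slice** (storey 12's `hD𝒪m` from its `h𝒪m`) — module 48's
`older_letters`. [cite: Balaban1988RG2Cluster, Lemma 2 (1.42) p.11 (bookkeeping)] -/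
theorem measurable_linPart (Y : TDom P.d (L * domCount P M (k + 1))) (h : Measurable (𝒪 Z t old φ Y)) :
    Measurable (linPart (J.Oc Y)) :=
  (older_letters (half_lt_self J.hR) J.hR (J.hOd Y) (J.hOM Y)).2.2.2.2.2 (J.olderR_eq Y ▸ h)

/-- **The differential IS the Fréchet differential of `𝒪ᶜ(Y,·)` at the zero field on real fields**: `D𝒪(Y, A) = D𝒪ᶜ(Y)(0)·(A ↪ ℂ)` —
module 48's `linPart_eq_fderiv`. [cite: Balaban1988RG2Cluster, Lemma 2 (1.42) p.11 and (1.36) p.9 (bookkeeping)] -/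
theorem linPart_eq_fderiv (Y : TDom P.d (L * domCount P M (k + 1))) (A : (𝔇.𝒦 Z t).Λ → ℝ) :
    linPart (J.Oc Y) A = fderiv ℂ (J.Oc Y) 0 (ofRealVec A) :=
  B13Lemma2LeadingParts.linPart_eq_fderiv J.hR (J.hOd Y) A

end Lemma2Inputs

/-! ## §3  The located extension and the constructor of storey 12's record -/

/-- **LEMMA 2's SENTENCE + THE LOCATED NON-LEMMA-2 DATA OF STOREY 12, AS ONE RECORD** (extends `Lemma2Inputs`; Type-valued list of
hypotheses; nothing asserted).  Next to print's sentence: the box radius `ρ` with `0 < ρ < R` ([I] (2.9): the boxes' threshold `ε₁` on the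
unscaled field, INSIDE the analyticity ball so that Lemma 2's letters hold on the boxes' support); measurability of the real slices
`𝒲(φ;Y,·), 𝒪(old,φ;Y,·)` (global; not a consequence of analyticity on a ball); the τ-radii bounds `Rτ(Y)` of the per-domain regions `Uτ`
((2.18)); the CUBE-LOCATION `cubeOf` of the row bonds with (G) `b ∈ S Y → cubeOf b ∈ Y`; the (2.19) PROFILE of the rate weight
`Rτ(Y)·(M𝒲(Y)∕R³)` — decay in the torus tree length at a rate `κ_p ≥ κ₀(4·2^d, 2d)` with constant `C_p ≥ 0` (p. 16: *"We use the first
exponential factor in (2.19) to bound the sum, and this yields a constant O(1)"*); the box-support coordinate set `S₀` ((2.2)–(2.3): the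
bonds of `Y₀ = ⋃_{Y∈𝐃} Y`) with `S Y ⊆ S₀` on `𝐃` and the s-FREE box-support law `χᵘ(A) ≠ 0 → |A_b| ≤ ρ (b ∈ S₀)`.
[cite: Balaban1988RG2Cluster, Lemma 2 (1.41)-(1.43) p.11, (2.2)-(2.3) p.12, (2.18)-(2.20) p.16, (1.26) p.8; Balaban1987RG1, (2.8)-(2.9) p.266] -/
structure AnalyticGrowthInputs (Z : (domSys P M (k + 1)).Dom) (t : TermLabel P M k L) (old : OlderTerms P 𝔸 M k) (φ : CPair P 𝔸)
    (Uτ : TDom P.d (L * domCount P M (k + 1)) → Set ℂ) extends 𝔇.Lemma2Inputs 𝒲 𝒪 Z t old φ where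
  -- the box radius (print's ε₁ on the unscaled field), inside the analyticity ball
  ρ : ℝ
  hρ : 0 < ρ
  hρR : ρ < R
  -- measurability of the real slices in the unscaled row-bond field
  h𝒲m : ∀ Y, Measurable (𝒲 Z t φ Y)
  h𝒪m : ∀ Y, Measurable (𝒪 Z t old φ Y)
  -- the τ-radii bounds of the per-domain regions
  Rτ : TDom P.d (L * domCount P M (k + 1)) → ℝ
  hRτ : ∀ Y ∈ t.1, 0 ≤ Rτ Y
  hUτR : ∀ Y ∈ t.1, ∀ z ∈ Uτ Y, ‖z‖ ≤ Rτ Y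
  -- (G) the cube-location of the row bonds, the supports `S Y` lying in `Y`
  cubeOf : (𝔇.𝒦 Z t).Λ → TPt P.d (L * domCount P M (k + 1))
  hS : ∀ Y ∈ t.1, ∀ b ∈ S Y, cubeOf b ∈ Y.1
  -- (P) the (2.19) profile of the rate weight `Rτ(Y)·(M𝒲(Y)∕R³)` in the torus tree length
  Cp : ℝ
  κp : ℝ
  hCp : 0 ≤ Cp
  hκp : kappa₀ (4 * 2 ^ P.d) (2 * P.d) ≤ κp
  hdecay : ∀ Y ∈ t.1, Rτ Y * (M𝒲 Y / R ^ 3) ≤ Cp * Real.exp (-κp * (tsys P.d (L * domCount P M (k + 1))).dj Y)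
  -- the box-support coordinate set `S₀` (bonds of Y₀ = ⋃ Y), `S Y ⊆ S₀` on 𝐃, and the s-free box-support law of `χᵘ`
  S₀ : Set (𝔇.𝒦 Z t).Λ
  hSS₀ : ∀ Y ∈ t.1, ∀ b ∈ S Y, b ∈ S₀
  hbox : ∀ A : (𝔇.𝒦 Z t).Λ → ℝ, χu Z t A ≠ 0 → ∀ b ∈ S₀, |A b| ≤ ρ

/-- **Propositional shadow**: Lemma 2's sentence with the located data HOLDS at the slice (some record exists).
[cite: Balaban1988RG2Cluster, Lemma 2 (1.41)-(1.43) p.11 (bookkeeping)] -/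
def AnalyticGrowthLetters (Z : (domSys P M (k + 1)).Dom) (t : TermLabel P M k L) (old : OlderTerms P 𝔸 M k) (φ : CPair P 𝔸)
    (Uτ : TDom P.d (L * domCount P M (k + 1)) → Set ℂ) : Prop :=
  Nonempty (𝔇.AnalyticGrowthInputs χu 𝒲 𝒪 Z t old φ Uτ)

namespace LocalGrowthInputs

variable {𝔇 χu 𝒲 𝒪}
variable {Z : (domSys P M (k + 1)).Dom} {t : TermLabel P M k L} {old : OlderTerms P 𝔸 M k} {φ : CPair P 𝔸}
  {Uτ : TDom P.d (L * domCount P M (k + 1)) → Set ℂ}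

/-- **THE CONSTRUCTOR OF STOREY 12's LOCAL GROWTH RECORD FROM LEMMA 2's SENTENCE** (lens demand d15): every Lemma-2-type field of
`LocalGrowthInputs` DERIVED — `𝒲₃ Y := cubicPart (𝒲ᶜ Y)`, `D𝒪 Y := linPart (𝒪ᶜ Y)`, `c₃ = c₃′ := M𝒲∕R³`, `c₄ := 2M𝒲∕R⁴`, `c₀ := M𝒪`,
`c₁ = c₁′ := 2M𝒪∕R`, `c₂ := 4M𝒪∕R²`, homogeneity ∕ measurability ∕ (L0)–(L6) by module 48's `wilson_letters ∕ older_letters`, (ℓ1) by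
`loc_of_cubic_of_local`, nonnegativity by `consts_nonneg`, the `S₀`-localities from `Y`-locality and `S Y ⊆ S₀` — and the located
non-Lemma-2 fields COPIED (`ρ`, measurability, `R := Rτ`, `S`, `cubeOf`, (G), the profile, `S₀`, the box law).  So the inhabitant of
record supplies print's sentence, the (2.19) profile and the cube-location ONLY; the consumers read `I := ofAnalytic J` field by field as
before (the derived per-bond multiplicity `I.hm₃` included).
[cite: Balaban1988RG2Cluster, Lemma 2 (1.41)-(1.43) p.11, (1.34) and (1.36) p.9, (1.39) p.10, (2.2)-(2.3) p.12, (2.18)-(2.20) p.16; Balaban1987RG1, (2.8)-(2.9) p.266] -/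
def ofAnalytic (J : 𝔇.AnalyticGrowthInputs χu 𝒲 𝒪 Z t old φ Uτ) : 𝔇.LocalGrowthInputs χu 𝒲 𝒪 Z t old φ Uτ where
  𝒲₃ := fun Y => cubicPart (J.Wc Y)
  D𝒪 := fun Y => linPart (J.Oc Y)
  ρ := J.ρ
  hρ := J.hρ
  h𝒲m := J.h𝒲m
  h𝒪m := J.h𝒪m
  h𝒲₃m := fun Y => J.measurable_cubicPart Y (J.h𝒲m Y)
  hD𝒪m := fun Y => J.measurable_linPart Y (J.h𝒪m Y)
  h𝒲₃ := fun Y r A => J.cubicPart_smul Y r A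
  hD𝒪 := fun Y r A => J.linPart_smul Y r A
  R := J.Rτ
  c₀ := J.M𝒪
  c₃ := fun Y => J.M𝒲 Y / J.R ^ 3
  c₃' := fun Y => J.M𝒲 Y / J.R ^ 3
  c₄ := fun Y => 2 * J.M𝒲 Y / J.R ^ 4
  c₁ := fun Y => 2 * J.M𝒪 Y / J.R
  c₁' := fun Y => 2 * J.M𝒪 Y / J.R
  c₂ := fun Y => 4 * J.M𝒪 Y / J.R ^ 2
  hR := J.hRτ
  hc₃ := fun Y _ => J.c₃_nonneg Y
  hc₃' := fun Y _ => J.c₃_nonneg Y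
  hc₄ := fun Y _ => J.c₄_nonneg Y
  hc₁ := fun Y _ => J.c₁_nonneg Y
  hc₁' := fun Y _ => J.c₁_nonneg Y
  hc₂ := fun Y _ => J.c₂_nonneg Y
  hUτR := J.hUτR
  h0 := fun Y _ => J.h0 Y
  h1 := fun Y _ A hA => J.h1_of J.hρR Y A hA
  S := J.S
  h1loc := fun Y _ A hA => J.h1loc_of J.hρR Y A hA
  cubeOf := J.cubeOf
  hS := J.hS
  Cp := J.Cp
  κp := J.κp
  hCp := J.hCp
  hκp := J.hκp
  hdecay := J.hdecay
  h2 := fun Y _ A hA => J.h2_of J.hρR Y A hA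
  h3 := fun Y _ A => J.h3 Y A
  h4 := fun Y _ A hA => J.h4_of J.hρR Y A hA
  h5 := fun Y _ A hA => J.h5_of J.hρR Y A hA
  h6 := fun Y _ A => J.h6 Y A
  S₀ := J.S₀
  hbox := J.hbox
  hloc𝒲 := fun Y hY A A' h => J.hloc𝒲 Y A A' fun b hb => h b (J.hSS₀ Y hY b hb)
  hloc𝒪 := fun Y hY A A' h => J.hloc𝒪 Y A A' fun b hb => h b (J.hSS₀ Y hY b hb)

variable (J : 𝔇.AnalyticGrowthInputs χu 𝒲 𝒪 Z t old φ Uτ)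

/-- `ofAnalytic`: the cubic part is `cubicPart ∘ 𝒲ᶜ` (`rfl`). [cite: Balaban1988RG2Cluster, Lemma 2 (1.41)-(1.42) p.11 (bookkeeping)] -/
@[simp] theorem ofAnalytic_𝒲₃ : (ofAnalytic J).𝒲₃ = fun Y => cubicPart (J.Wc Y) := rfl

/-- `ofAnalytic`: `𝒲₃(Y, A) = homPart (𝒲ᶜ Y) 3 (A ↪ ℂ)` (`rfl`). [cite: Balaban1988RG2Cluster, Lemma 2 (1.41)-(1.42) p.11 (bookkeeping)] -/
theorem ofAnalytic_𝒲₃_apply (Y : TDom P.d (L * domCount P M (k + 1))) (A : (𝔇.𝒦 Z t).Λ → ℝ) :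
    (ofAnalytic J).𝒲₃ Y A = homPart (J.Wc Y) 3 (ofRealVec A) := rfl

/-- `ofAnalytic`: the differential is `linPart ∘ 𝒪ᶜ` (`rfl`). [cite: Balaban1988RG2Cluster, Lemma 2 (1.42) p.11 (bookkeeping)] -/
@[simp] theorem ofAnalytic_D𝒪 : (ofAnalytic J).D𝒪 = fun Y => linPart (J.Oc Y) := rfl

/-- `ofAnalytic`: `D𝒪(Y, A) = D𝒪ᶜ(Y)(0)·(A ↪ ℂ)` — the differential IS the Fréchet differential at the zero field.
[cite: Balaban1988RG2Cluster, Lemma 2 (1.42) p.11 and (1.36) p.9 (bookkeeping)] -/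
theorem ofAnalytic_D𝒪_eq_fderiv (Y : TDom P.d (L * domCount P M (k + 1))) (A : (𝔇.𝒦 Z t).Λ → ℝ) :
    (ofAnalytic J).D𝒪 Y A = fderiv ℂ (J.Oc Y) 0 (ofRealVec A) :=
  J.linPart_eq_fderiv Y A

/-- `ofAnalytic`: the sup-ball radius is the box radius `ρ` (`rfl`). [cite: Balaban1987RG1, (2.9) p.266 (bookkeeping)] -/
@[simp] theorem ofAnalytic_ρ : (ofAnalytic J).ρ = J.ρ := rfl

/-- `ofAnalytic`: the τ-radii bounds (`rfl`). [cite: Balaban1988RG2Cluster, (2.18) p.16 (bookkeeping)] -/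
@[simp] theorem ofAnalytic_R : (ofAnalytic J).R = J.Rτ := rfl

/-- `ofAnalytic`: `c₀ = M𝒪` (`rfl`). [cite: Balaban1988RG2Cluster, (1.36) p.9 (bookkeeping)] -/
@[simp] theorem ofAnalytic_c₀ : (ofAnalytic J).c₀ = J.M𝒪 := rfl

/-- `ofAnalytic`: `c₃ = M𝒲∕R³` (`rfl`). [cite: Balaban1988RG2Cluster, (1.39) p.10 (bookkeeping)] -/
@[simp] theorem ofAnalytic_c₃ : (ofAnalytic J).c₃ = fun Y => J.M𝒲 Y / J.R ^ 3 := rfl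

/-- `ofAnalytic`: `c₃′ = M𝒲∕R³` (`rfl`). [cite: Balaban1988RG2Cluster, (1.39) p.10 (bookkeeping)] -/
@[simp] theorem ofAnalytic_c₃' : (ofAnalytic J).c₃' = fun Y => J.M𝒲 Y / J.R ^ 3 := rfl

/-- `ofAnalytic`: `c₄ = 2M𝒲∕R⁴` (`rfl`). [cite: Balaban1988RG2Cluster, (1.39)-(1.40) p.10 (bookkeeping)] -/
@[simp] theorem ofAnalytic_c₄ : (ofAnalytic J).c₄ = fun Y => 2 * J.M𝒲 Y / J.R ^ 4 := rfl

/-- `ofAnalytic`: `c₁ = 2M𝒪∕R` (`rfl`). [cite: Balaban1988RG2Cluster, (1.36) p.9 (bookkeeping)] -/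
@[simp] theorem ofAnalytic_c₁ : (ofAnalytic J).c₁ = fun Y => 2 * J.M𝒪 Y / J.R := rfl

/-- `ofAnalytic`: `c₁′ = 2M𝒪∕R` (`rfl`). [cite: Balaban1988RG2Cluster, (1.36) p.9 (bookkeeping)] -/
@[simp] theorem ofAnalytic_c₁' : (ofAnalytic J).c₁' = fun Y => 2 * J.M𝒪 Y / J.R := rfl

/-- `ofAnalytic`: `c₂ = 4M𝒪∕R²` (`rfl`). [cite: Balaban1988RG2Cluster, (1.36) p.9 (bookkeeping)] -/
@[simp] theorem ofAnalytic_c₂ : (ofAnalytic J).c₂ = fun Y => 4 * J.M𝒪 Y / J.R ^ 2 := rfl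

/-- `ofAnalytic`: the bond supports are Lemma 2's (`rfl`). [cite: Balaban1988RG2Cluster, (1.34) p.9 (bookkeeping)] -/
@[simp] theorem ofAnalytic_S : (ofAnalytic J).S = J.S := rfl

/-- `ofAnalytic`: the cube-location (`rfl`). [cite: Balaban1988RG2Cluster, (2.19)-(2.20) p.16 (bookkeeping)] -/
@[simp] theorem ofAnalytic_cubeOf : (ofAnalytic J).cubeOf = J.cubeOf := rfl

/-- `ofAnalytic`: the profile constant (`rfl`). [cite: Balaban1988RG2Cluster, (2.19) p.16 (bookkeeping)] -/
@[simp] theorem ofAnalytic_Cp : (ofAnalytic J).Cp = J.Cp := rfl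

/-- `ofAnalytic`: the profile rate (`rfl`). [cite: Balaban1988RG2Cluster, (2.19) p.16 (bookkeeping)] -/
@[simp] theorem ofAnalytic_κp : (ofAnalytic J).κp = J.κp := rfl

/-- `ofAnalytic`: the box-support set (`rfl`). [cite: Balaban1988RG2Cluster, (2.2)-(2.3) p.12 (bookkeeping)] -/
@[simp] theorem ofAnalytic_S₀ : (ofAnalytic J).S₀ = J.S₀ := rfl

/-- `ofAnalytic`: the DERIVED per-bond multiplicity constant reads `m₃ = C_p·K₀(4·2^d, 2d)` off the profile (`rfl`; the bound `hm₃` is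
storey 12's face, (1.26) on the torus). [cite: Balaban1988RG2Cluster, (2.19)-(2.20) p.16 and (1.26) p.8 (bookkeeping)] -/
theorem ofAnalytic_m₃ : (ofAnalytic J).m₃ = J.Cp * K₀ (4 * 2 ^ P.d) (2 * P.d) := rfl

/-- **The rate weight of the derived record IS the profile's**: `R(Y)c₃(Y) = Rτ(Y)·(M𝒲(Y)∕R³)` (`rfl`), so storey 12's DERIVED per-bond
multiplicity `(ofAnalytic J).hm₃ : Σ_{Y∈𝐃, b∈S Y} Rτ(Y)·(M𝒲(Y)∕R³) ≤ C_p·K₀(4·2^d, 2d)` is print's «constant O(1)» of p. 16 for Lemma 2's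
sup bounds. [cite: Balaban1988RG2Cluster, (2.19)-(2.20) p.16 and (1.26) p.8 (bookkeeping)] -/
theorem ofAnalytic_rateWeight (Y : TDom P.d (L * domCount P M (k + 1))) :
    (ofAnalytic J).R Y * (ofAnalytic J).c₃ Y = J.Rτ Y * (J.M𝒲 Y / J.R ^ 3) := rfl

/-- The shadows: Lemma 2's sentence with the located data gives storey 12's local growth letters.
[cite: Balaban1988RG2Cluster, Lemma 2 (1.41)-(1.43) p.11 (bookkeeping)] -/
theorem _root_.Literature.MathematicalPhysics.QuantumFieldTheory.Balaban1983to89.Node00.W1.TermDatum214.AnalyticGrowthLetters.localGrowthLetters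
    (h : 𝔇.AnalyticGrowthLetters χu 𝒲 𝒪 Z t old φ Uτ) : 𝔇.LocalGrowthLetters χu 𝒲 𝒪 Z t old φ Uτ :=
  h.elim fun J => ⟨ofAnalytic J⟩

end LocalGrowthInputs

namespace AnalyticGrowthInputs

variable {𝔇 χu 𝒲 𝒪}
variable {Z : (domSys P M (k + 1)).Dom} {t : TermLabel P M k L} {old : OlderTerms P 𝔸 M k} {φ : CPair P 𝔸}
  {Uτ : TDom P.d (L * domCount P M (k + 1)) → Set ℂ}

/-- The shadow holds as soon as a record is given. [cite: Balaban1988RG2Cluster, Lemma 2 p.11 (bookkeeping)] -/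
theorem letters (J : 𝔇.AnalyticGrowthInputs χu 𝒲 𝒪 Z t old φ Uτ) : 𝔇.AnalyticGrowthLetters χu 𝒲 𝒪 Z t old φ Uτ := ⟨J⟩

/-- Storey 12's shadow from a record. [cite: Balaban1988RG2Cluster, Lemma 2 p.11 (bookkeeping)] -/
theorem localGrowthLetters (J : 𝔇.AnalyticGrowthInputs χu 𝒲 𝒪 Z t old φ Uτ) : 𝔇.LocalGrowthLetters χu 𝒲 𝒪 Z t old φ Uτ :=
  ⟨LocalGrowthInputs.ofAnalytic J⟩

/-- **Antitone in the τ-regions**: inputs for regions `Uτ` are inputs for any smaller regions on `𝐃`, all other fields kept.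
[cite: Balaban1988RG2Cluster, (2.18) p.16 (bookkeeping)] -/
def restrict (J : 𝔇.AnalyticGrowthInputs χu 𝒲 𝒪 Z t old φ Uτ) {Uτ' : TDom P.d (L * domCount P M (k + 1)) → Set ℂ}
    (hU : ∀ Y ∈ t.1, Uτ' Y ⊆ Uτ Y) : 𝔇.AnalyticGrowthInputs χu 𝒲 𝒪 Z t old φ Uτ' :=
  { J with hUτR := fun Y hY z hz => J.hUτR Y hY z (hU Y hY hz) }

/-- `restrict` keeps Lemma 2's sentence. [cite: Balaban1988RG2Cluster, (2.18) p.16 (bookkeeping)] -/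
@[simp] theorem restrict_toLemma2Inputs (J : 𝔇.AnalyticGrowthInputs χu 𝒲 𝒪 Z t old φ Uτ) {Uτ' : TDom P.d (L * domCount P M (k + 1)) → Set ℂ}
    (hU : ∀ Y ∈ t.1, Uτ' Y ⊆ Uτ Y) : (J.restrict hU).toLemma2Inputs = J.toLemma2Inputs := rfl

/-- `restrict` keeps the box radius. [cite: Balaban1988RG2Cluster, (2.18) p.16 (bookkeeping)] -/
@[simp] theorem restrict_ρ (J : 𝔇.AnalyticGrowthInputs χu 𝒲 𝒪 Z t old φ Uτ) {Uτ' : TDom P.d (L * domCount P M (k + 1)) → Set ℂ}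
    (hU : ∀ Y ∈ t.1, Uτ' Y ⊆ Uτ Y) : (J.restrict hU).ρ = J.ρ := rfl

/-- **The constructor commutes with restriction of the τ-regions** (`rfl`). [cite: Balaban1988RG2Cluster, (2.18) p.16 (bookkeeping)] -/
theorem ofAnalytic_restrict (J : 𝔇.AnalyticGrowthInputs χu 𝒲 𝒪 Z t old φ Uτ) {Uτ' : TDom P.d (L * domCount P M (k + 1)) → Set ℂ}
    (hU : ∀ Y ∈ t.1, Uτ' Y ⊆ Uτ Y) : LocalGrowthInputs.ofAnalytic (J.restrict hU) = (LocalGrowthInputs.ofAnalytic J).restrict hU := rfl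

/-- The shadow is antitone in the τ-regions. [cite: Balaban1988RG2Cluster, (2.18) p.16 (bookkeeping)] -/
theorem _root_.Literature.MathematicalPhysics.QuantumFieldTheory.Balaban1983to89.Node00.W1.TermDatum214.AnalyticGrowthLetters.restrict
    (h : 𝔇.AnalyticGrowthLetters χu 𝒲 𝒪 Z t old φ Uτ) {Uτ' : TDom P.d (L * domCount P M (k + 1)) → Set ℂ}
    (hU : ∀ Y ∈ t.1, Uτ' Y ⊆ Uτ Y) : 𝔇.AnalyticGrowthLetters χu 𝒲 𝒪 Z t old φ Uτ' :=
  h.elim fun J => ⟨J.restrict hU⟩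

end AnalyticGrowthInputs

/-! ## §3b  Over an admissible class of older terms (the consumer's binder shape; lens d16, repair (R-a)) -/

/-- **Lemma 2's sentence with the located data OVER AN ADMISSIBLE CLASS `Adm` OF OLDER TERMS** at `(Z, t, φ)`: `∀ old ∈ Adm, AnalyticGrowthLetters
… Z t old φ Uτ`.  The datum's law (W1-11) reads `𝒪(old, φ; Y, ·)` for EVERY bare `old` (total, faithful: evaluation at the fluctuation-moved
configurations); print's letters hold for the ADMISSIBLE histories only ([I] p. 263, (1.18): the previous terms are *"defined and analytic"*
on the configuration spaces) — W1's uninstantiated class parameter `Adm : (k : ℕ) → Set (OlderTerms P 𝔸 M k)` of `RecAdmissible ∕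
StepGen.AnalyticInLast ∕ StepGen.PropagatesAnalyticity` (storey 4), instantiated by the consumer (size ∧ field-analyticity on the level
tables).  No junk branch in the datum. [cite: Balaban1987RG1, (1.18) p.263 and (2.10) p.267; Balaban1988RG2Cluster, Lemma 2 (1.41)-(1.43) p.11] -/
def AnalyticGrowthLettersOn (Adm : Set (OlderTerms P 𝔸 M k)) (Z : (domSys P M (k + 1)).Dom) (t : TermLabel P M k L) (φ : CPair P 𝔸)
    (Uτ : TDom P.d (L * domCount P M (k + 1)) → Set ℂ) : Prop :=
  ∀ old ∈ Adm, 𝔇.AnalyticGrowthLetters χu 𝒲 𝒪 Z t old φ Uτ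

/-- **Storey 12's local growth letters OVER AN ADMISSIBLE CLASS `Adm` OF OLDER TERMS** at `(Z, t, φ)`: `∀ old ∈ Adm, LocalGrowthLetters … Z t old
φ Uτ` (same reading). [cite: Balaban1987RG1, (1.18) p.263; Balaban1988RG2Cluster, Lemma 2 (1.41)-(1.43) p.11 and (1.36) p.9] -/
def LocalGrowthLettersOn (Adm : Set (OlderTerms P 𝔸 M k)) (Z : (domSys P M (k + 1)).Dom) (t : TermLabel P M k L) (φ : CPair P 𝔸)
    (Uτ : TDom P.d (L * domCount P M (k + 1)) → Set ℂ) : Prop :=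
  ∀ old ∈ Adm, 𝔇.LocalGrowthLetters χu 𝒲 𝒪 Z t old φ Uτ

section OnClass

variable {𝔇 χu 𝒲 𝒪}
variable {Adm Adm' : Set (OlderTerms P 𝔸 M k)} {Z : (domSys P M (k + 1)).Dom} {t : TermLabel P M k L} {φ : CPair P 𝔸}
  {Uτ Uτ' : TDom P.d (L * domCount P M (k + 1)) → Set ℂ}

/-- Over a class, Lemma 2's located sentence gives storey 12's letters (`ofAnalytic` per `old`). [cite: Balaban1988RG2Cluster, Lemma 2 p.11 (bookkeeping)] -/
theorem AnalyticGrowthLettersOn.localGrowthLettersOn (h : 𝔇.AnalyticGrowthLettersOn χu 𝒲 𝒪 Adm Z t φ Uτ) :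
    𝔇.LocalGrowthLettersOn χu 𝒲 𝒪 Adm Z t φ Uτ :=
  fun old hold => (h old hold).localGrowthLetters

/-- Antitone in the class. [cite: Balaban1987RG1, (1.18) p.263 (bookkeeping)] -/
theorem AnalyticGrowthLettersOn.anti (h : 𝔇.AnalyticGrowthLettersOn χu 𝒲 𝒪 Adm Z t φ Uτ) (hA : Adm' ⊆ Adm) :
    𝔇.AnalyticGrowthLettersOn χu 𝒲 𝒪 Adm' Z t φ Uτ :=
  fun old hold => h old (hA hold)

/-- Antitone in the class. [cite: Balaban1987RG1, (1.18) p.263 (bookkeeping)] -/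
theorem LocalGrowthLettersOn.anti (h : 𝔇.LocalGrowthLettersOn χu 𝒲 𝒪 Adm Z t φ Uτ) (hA : Adm' ⊆ Adm) :
    𝔇.LocalGrowthLettersOn χu 𝒲 𝒪 Adm' Z t φ Uτ :=
  fun old hold => h old (hA hold)

/-- Antitone in the τ-regions, over a class. [cite: Balaban1988RG2Cluster, (2.18) p.16 (bookkeeping)] -/
theorem AnalyticGrowthLettersOn.restrict (h : 𝔇.AnalyticGrowthLettersOn χu 𝒲 𝒪 Adm Z t φ Uτ) (hU : ∀ Y ∈ t.1, Uτ' Y ⊆ Uτ Y) :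
    𝔇.AnalyticGrowthLettersOn χu 𝒲 𝒪 Adm Z t φ Uτ' :=
  fun old hold => (h old hold).restrict hU

/-- Antitone in the τ-regions, over a class. [cite: Balaban1988RG2Cluster, (2.18) p.16 (bookkeeping)] -/
theorem LocalGrowthLettersOn.restrict (h : 𝔇.LocalGrowthLettersOn χu 𝒲 𝒪 Adm Z t φ Uτ) (hU : ∀ Y ∈ t.1, Uτ' Y ⊆ Uτ Y) :
    𝔇.LocalGrowthLettersOn χu 𝒲 𝒪 Adm Z t φ Uτ' :=
  fun old hold => (h old hold).restrict hU

end OnClass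

/-! ## §4  Honesty: the schemas are consistent (inhabited by the zero complex potentials) -/

section Honesty

variable {𝔇}

/-- The zero function begins at every order (every slice is the zero germ). [cite: Balaban1987RG1, (2.8) p.266 (bookkeeping)] -/
theorem beginsAt_zero_fun {E F : Type*} [NormedAddCommGroup E] [NormedSpace ℂ E] [NormedAddCommGroup F] (n : ℕ) :
    BeginsAt (fun _ : E => (0 : F)) n := by
  intro w
  refine B11SchwarzRemainder.OrderGe.of_bound_on_ball one_pos (C := 0) fun t _ => ?_
  simp [B13ExpansionOrder.slice]

variable (𝔇)

/-- **The zero complex potentials inhabit Lemma 2's sentence for the zero real potentials** (`R = 1`, `M𝒲 = M𝒪 = 0`, empty supports).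
Consistency witness only — NOT Bałaban's potentials (`M𝒲 = M𝒪 = 0`). [cite: Balaban1988RG2Cluster, Lemma 2 p.11 (bookkeeping)] -/
def lemma2InputsZero (Z : (domSys P M (k + 1)).Dom) (t : TermLabel P M k L) (old : OlderTerms P 𝔸 M k) (φ : CPair P 𝔸) :
    𝔇.Lemma2Inputs (fun _ _ _ _ _ => 0) (fun _ _ _ _ _ _ => 0) Z t old φ where
  Wc := fun _ _ => 0
  Oc := fun _ _ => 0
  R := 1
  hR := one_pos
  M𝒲 := fun _ => 0
  M𝒪 := fun _ => 0
  h𝒲re := fun _ _ => rfl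
  h𝒪re := fun _ _ => rfl
  hWd := fun _ => differentiableOn_const 0
  hWM := fun _ _ _ => by simp
  hWB := fun _ => beginsAt_zero_fun 3
  hOd := fun _ => differentiableOn_const 0
  hOM := fun _ _ _ => by simp
  S := fun _ => ∅
  hloc𝒲 := fun _ _ _ _ => rfl
  hloc𝒪 := fun _ _ _ _ => rfl

/-- **The zero complex potentials with the zero profile inhabit the located extension** as soon as the τ-regions are bounded on `𝐃` (box
radius `1∕2` inside the unit analyticity ball, `S₀ = ∅`, zero profile at the threshold rate, all bonds located at the cube `0`; the bound
`Rτ(Y)` is the given one).  Consistency witness only. [cite: Balaban1988RG2Cluster, Lemma 2 p.11 and (2.18)-(2.19) p.16 (bookkeeping)] -/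
def analyticGrowthInputsZero (Z : (domSys P M (k + 1)).Dom) (t : TermLabel P M k L) (old : OlderTerms P 𝔸 M k) (φ : CPair P 𝔸)
    (Uτ : TDom P.d (L * domCount P M (k + 1)) → Set ℂ) (Rb : TDom P.d (L * domCount P M (k + 1)) → ℝ) (hRb : ∀ Y ∈ t.1, 0 ≤ Rb Y)
    (hU : ∀ Y ∈ t.1, ∀ z ∈ Uτ Y, ‖z‖ ≤ Rb Y) :
    𝔇.AnalyticGrowthInputs χu (fun _ _ _ _ _ => 0) (fun _ _ _ _ _ _ => 0) Z t old φ Uτ where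
  toLemma2Inputs := 𝔇.lemma2InputsZero Z t old φ
  ρ := 1 / 2
  hρ := by norm_num
  hρR := by show (1 : ℝ) / 2 < 1; norm_num
  h𝒲m := fun _ => measurable_const
  h𝒪m := fun _ => measurable_const
  Rτ := Rb
  hRτ := hRb
  hUτR := hU
  cubeOf := fun _ => 0
  hS := fun _ _ _ hb => (Finset.notMem_empty _ hb).elim
  Cp := 0
  κp := kappa₀ (4 * 2 ^ P.d) (2 * P.d)
  hCp := le_rfl
  hκp := le_rfl
  hdecay := fun _ _ => by show Rb _ * (0 / (1 : ℝ) ^ 3) ≤ 0 * _; simp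
  S₀ := ∅
  hSS₀ := fun _ _ _ hb => (Finset.notMem_empty _ hb).elim
  hbox := fun _ _ _ hb => (Set.notMem_empty _ hb).elim

/-- The located shadow for the zero potentials, under bounded τ-regions on `𝐃`. [cite: Balaban1988RG2Cluster, Lemma 2 p.11 (bookkeeping)] -/
theorem analyticGrowthLetters_zero (Z : (domSys P M (k + 1)).Dom) (t : TermLabel P M k L) (old : OlderTerms P 𝔸 M k) (φ : CPair P 𝔸)
    {Uτ : TDom P.d (L * domCount P M (k + 1)) → Set ℂ} (hU : ∀ Y ∈ t.1, ∃ Rb : ℝ, 0 ≤ Rb ∧ ∀ z ∈ Uτ Y, ‖z‖ ≤ Rb) :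
    𝔇.AnalyticGrowthLetters χu (fun _ _ _ _ _ => 0) (fun _ _ _ _ _ _ => 0) Z t old φ Uτ := by
  classical
  refine ⟨𝔇.analyticGrowthInputsZero χu Z t old φ Uτ (fun Y => if h : Y ∈ t.1 then (hU Y h).choose else 0) ?_ ?_⟩
  · intro Y hY; simp only [dif_pos hY]; exact (hU Y hY).choose_spec.1
  · intro Y hY z hz; simp only [dif_pos hY]; exact (hU Y hY).choose_spec.2 z hz

/-- **Storey 12's record through the constructor, for the zero potentials** — `ofAnalytic` of the zero witness: its radius is the box
radius `1∕2` and its cubic constant vanishes (`rfl`; the constructor's hypotheses are jointly satisfiable and the derived record is the expected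
one). [cite: Balaban1988RG2Cluster, Lemma 2 p.11 (bookkeeping)] -/
theorem ofAnalytic_zero_ρ_c₃ (Z : (domSys P M (k + 1)).Dom) (t : TermLabel P M k L) (old : OlderTerms P 𝔸 M k) (φ : CPair P 𝔸)
    (Uτ : TDom P.d (L * domCount P M (k + 1)) → Set ℂ) (Rb : TDom P.d (L * domCount P M (k + 1)) → ℝ) (hRb : ∀ Y ∈ t.1, 0 ≤ Rb Y)
    (hU : ∀ Y ∈ t.1, ∀ z ∈ Uτ Y, ‖z‖ ≤ Rb Y) (Y : TDom P.d (L * domCount P M (k + 1))) :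
    (LocalGrowthInputs.ofAnalytic (𝔇.analyticGrowthInputsZero χu Z t old φ Uτ Rb hRb hU)).ρ = 1 / 2 ∧
      (LocalGrowthInputs.ofAnalytic (𝔇.analyticGrowthInputsZero χu Z t old φ Uτ Rb hRb hU)).c₃ Y = 0 :=
  ⟨rfl, by show (0 : ℝ) / (1 : ℝ) ^ 3 = 0; simp⟩

end Honesty

end TermDatum214

end W1

end Literature.MathematicalPhysics.QuantumFieldTheory.Balaban1983to89.Node00

end
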